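import Summits.QuantumFields.YangMills.Theorems.BalabanLadderIRcofEquipartitionSeamBadRare
import HarnessLib

/-!
# Line `equipartition_seam` (crux `IRcof`, stmt-QuantumFields-26930): stub S6 `BadRareUnits` — POINTER (rev 2)

Rev 1 of this workfile (crux write 6156afc8779f, 401 l.) proved stub S6 by its text; it LANDED verbatim as
`Theorems/BalabanLadderIRcofEquipartitionSeamBadRare.lean` (LEAD lane ab-p1, LAND-ASK #7), whose `BadRare.badRareUnits_text` the
skeleton rev 7 cites by name (`badRareUnits_holds`).  This file is now a POINTER: it re-declares nothing and records, as a
kernel-checked `example`, that the landed theorem proves the S6 text verbatim.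

HONEST LABEL: support ∕ routine class; row 47 class PWP unchanged (walls S3 ∕ S5ᵛ untouched), mechanism 0; IRcof ∕ IR 0 ∕ 1;
nothing continuum ∕ OS; the Yang–Mills mass gap (Clay) is NOT proved.  Ideator `ym-ir-idea-22` g5, 2026-08-28.
-/

set_option autoImplicit false

open MeasureTheory
open Literature.MathematicalPhysics.QuantumFieldTheory Literature.MathematicalPhysics.QuantumLattice
open Summit.QuantumFields.YangMills.Theorems.NonSimplyConnectedLatticeGap

namespace Summit.QuantumFields.YangMills.Cruxes.IRcof.EquipartitionSeam.BadRare

/-- The S6 text verbatim, by the landed theorem. -/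
example :
    ∀ (G : Type) [Group G] [TopologicalSpace G] [IsTopologicalGroup G] [CompactSpace G] [MeasurableSpace G]
    [BorelSpace G], IsCompactSimpleLieGroup G → ∀ (H : Type) [Group H] [TopologicalSpace H] [IsTopologicalGroup H]
    [CompactSpace H] [MeasurableSpace H] [BorelSpace H], IsCompactSimpleLieGroup H → SimplyConnectedSpace H →
    ∀ (π : H →* G), Continuous π → Function.Surjective π → π.ker ≤ Subgroup.center H → (π.ker : Set H).Finite →
    π.ker ≠ ⊥ → ∀ (ρH : LatticeRep H) (r : LatticeRep G) (a : ℝ) (cls : Labelling π),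
    (∀ S : ℕ, TwistSectorInterface π ρH r a S (cls S)) → 0 < a →
      ∃ (β_c C : ℝ) (S_c : ℝ → ℕ), ∀ β : ℝ, β_c ≤ β → BadUnitOn π r β cls (S_c β) C :=
  badRareUnits_text

end Summit.QuantumFields.YangMills.Cruxes.IRcof.EquipartitionSeam.BadRare
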